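import Literature.Barriers.CriticalPhenomena.PlaquetteWalkHoleRootThinBoxCells
import Literature.Barriers.CriticalPhenomena.PlaquetteWalkHoleRootRingOffWall
import Literature.Barriers.CriticalPhenomena.PlaquetteWalkHoleRootRingThreeDoor
import HarnessLib

/-!
# Barrier catalogue (SAWScalingLimit): THIN-BOX LAW L, THE TABLE — around a hole one row off the wall a single removal
kills the far-cell defect iff it breaks a door, and the bottom pocket below `rootE` gives an isolated zero at `2π/3`

Leaf of `PlaquetteWalkHoleRootThinBoxCells` (the door below the root edge; thin-side positivity with abstract over witnesses;
`thinBox_hyps`), `PlaquetteWalkHoleRootRingOffWall` (`block_hroot_subset_boxMinus_of_bounds`; the ring blocks) and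
`PlaquetteWalkHoleRootRingThreeDoor` (the doors of `rootS`). Setting:
the `m × n` box, the hole `h` ONE row above the bottom wall (`h.2 = 1`), `3 ≤ h.1 ≤ m − 4`, `n ≥ 5`; root plaquette
`(h.1 + 1, 1)` rooted at its `W` side, far cell `(h.1 − 1, 1)`; ONE further cell `(x, y)` removed. The under route is EMPTY
(`PlaquetteWalkHoleRootThinSide`), so `VF = i·v·M_N` and everything is decided by the over route. In the reference frame (root
`(4, 2)`, hole `(3, 2)`; the bottom wall means rows `≥ 1`) the lane's kit jobs j291139–43 / j291349–50 searched over witnesses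
of both kinds avoiding each near cell: they EXIST for every near cell except the five the tree already explains
(`farSW`, `farWW`, `farNW`: doors of the far cell; `holeS`, `rootS`: the door below the root edge) and the bottom pocket
`pocketSE` of §0/§4, and §1–§2 certify the new
ones (`thinBlock…`, 20–26 arcs, the `PlaquetteWalkHoleRootInteriorNoKill` pattern) at every position.

* §0 (every domain) ★★★★ `ΩG.kindsIn_root_eq_of_wound_thinPocketSE`: hole absent, the column strictly below `holeS` shut,
  the cell below `rootS` and the pocket `(w.1 + 1, w.2 − 1)` absent ⇒ every WOUND walk carries two `θ`-corner arcs in the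
  root plaquette (its excursion takes the door `holeS | rootS` — `PlaquetteWalkHoleRootHoleColumn` — and can leave `rootS`
  only through the root plaquette's bottom side; then `ΩG.kindsIn_root_eq_of_cross_root_S`) ⇒ `ΩG.not_W1FreeOff_of_wound_thinPocketSE`,
  `ΩG.over_w1_killed_of_thinPocketSE`.
* §1–§2 the new witnesses and their every-position theorems.
* §3 `block_hroot_subset_boxMinus_of_bounds_far` and ★★★★★ `thinBox_cell_vertexFunctional_ne_zero`: any single cell other than
  the hole, the far cell, the root plaquette and the five door/column cells ⇒ `VF(θ) ≠ 0` for every `θ ∈ [π/3, 2π/3]`.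
  With `PlaquetteWalkHoleRootThinBoxCells` §2 (those five ⇒ `VF ≡ 0`) this is the complete single-removal table of the interior
  thin box: **a cell kills the defect iff it closes a door of the far cell or the door below the root edge** — no angle
  dependence at all, in contrast with LAW L two rows up (kill-forced zeros) and with the height-four box (isolated endpoint
  zeros, `PlaquetteWalkHoleRootThinBoxCells` §5) — except for the one bottom cell of §4.
* §4 ★★★★★ `thinBox_pocketSE_vertexFunctional_two_pi_div_three_eq_zero` / `thinBox_pocketSE_im_pos_of_lt`: the bottom cell
  `(h.1 + 2, 0)` below `rootE` removed ⇒ `VF(2π/3) = 0` EXACTLY and `Im VF > 0` on `[π/3, 2π/3)` — an isolated endpoint zero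
  from a BOTTOM-row cell (the lane's kit j291139/j291349: no `w₁`-free over witness ≤ 36 arcs; here the mechanism).

Not in print; venture lane «pcv-sawmu», seat b-step0 gen 27.

References: A. Glazman, I. Manolescu, arXiv:1708.00395v3, §1 (Fig. 1, Fig. 2, the remark after eq. (1)), §2.1, §4.2 and
Lemma 2.1 [GlazmanManolescu2019]; A. Glazman, Electron. Commun. Probab. 20 (2015) no. 86, Lemma 3.1, proof pp. 6–7
[Glazman2015WeightedSAW]; R. Courant, H. Robbins, *What is Mathematics?* (1941/1958), Ch. V Appendix §2 (the even–odd rule)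
[CourantRobbins1958].
-/

noncomputable section

open Set Function Complex

namespace Literature.Probability.RandomPlanarGeometry.SAW.YangBaxter

open Real

/-! ## §0 The bottom pocket below `rootE`: two `θ`-corners in the root plaquette -/

namespace ΩG

variable {D : Set Face} {w : Face}

/-- ★★★★ **THIN BOTTOM + `pocketSE` ABSENT ⇒ EVERY WOUND WALK CARRIES TWO `θ`-CORNER ARCS IN THE ROOT PLAQUETTE.** Hole
absent, the column strictly below `holeS` shut, the cell `(w.1, w.2 − 2)` below `rootS` absent and the south-eastern pocket
`(w.1 + 1, w.2 − 1)` absent. A wound walk's excursion takes the door `holeS | rootS` (`PlaquetteWalkHoleRootHoleColumn`);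
its arc in `rootS` can leave only NORTHWARDS (east: the pocket, south: the cell below — both absent), i.e. through the root
plaquette's bottom side — and then `kindsIn_root_eq_of_cross_root_S` gives the two `θ`-corners.
[cite: GlazmanManolescu2019, §1 (Fig. 1), Lemma 2.1] [cite: Glazman2015WeightedSAW, Lemma 3.1 (proof, pp. 6–7)]
[cite: CourantRobbins1958, Ch. V Appendix §2 (the even–odd rule)] -/
theorem kindsIn_root_eq_of_wound_thinPocketSE (hh : holeFaceW w ∉ D)
    (hcol : ∀ y : ℤ, y ≤ w.2 - 2 → ((w.1 - 1, y) : Face) ∉ D)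
    (hSS : ((w.1, w.2 - 2) : Face) ∉ D) (hP : ((w.1 + 1, w.2 - 1) : Face) ∉ D)
    (ω : ΩG D (w.side .W) (farW w)) (hr : RootedFace D (w.side .W) (farW w)) (h : ω.IsB2a) {θ : ℝ}
    (hW : ω.WE (fun _ => θ) ≠ excursionWinding θ ω.2.firstSideG (ω.z1 hr h) ω.1) :
    ω.2.kindsIn w = [.corner, .corner] := by
  obtain ⟨k, hk1, hk2, e⟩ := exists_excursion_nth_eq_rootS_W_of_wound_holeColumn hcol ω hr h hW
  have hB2 : ω.2.firstHitG + 1 < ω.2.arcs.length := h.1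
  have hkn : k < ω.2.arcs.length := by omega
  -- faces of the sides of `rootS`
  have fW : ((rootS w).side .W).faces = (((w.1 - 1, w.2 - 1) : Face), rootS w) := by
    rw [rootS_side_W_eq]; obtain ⟨a, b⟩ := w; simp [rootS, MidEdge.faces]
  have fE : ((rootS w).side .E).faces = (rootS w, ((w.1 + 1, w.2 - 1) : Face)) := by
    rw [rootS_side_E_faces]; obtain ⟨a, b⟩ := w; simp [rootS, rootSE]
  have fS : ((rootS w).side .S).faces = (((w.1, w.2 - 2) : Face), rootS w) := by
    rw [rootS_side_S_faces]; obtain ⟨a, b⟩ := w; simp [rootS, rootSS]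
  have hNS : (rootS w).side .N = w.side .S := (root_side_S_eq_rootS_side_N w).symm
  -- an arc of the walk in `rootS` with one end on its `W` side leaves / enters through `N` = `w.side .S`
  have key : ∀ {i : ℕ} (hi : i < ω.2.arcs.length), ω.2.fc i = rootS w →
      ∀ {s : Side}, (s = ω.2.sIn i ∨ s = ω.2.sOut i) → s ≠ .W →
      (0 < i ∨ s = ω.2.sOut i) → (rootS w).side s = w.side .S := by
    intro i hi hfc s hs hsW hpos
    -- the mid-edge `(rootS w).side s` is an interior mid-edge of the walk, so both its faces lie in `D`
    have hmid : ∃ j, 0 < j ∧ j < ω.2.arcs.length + 1 ∧ ω.2.nth j = (rootS w).side s ∧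
        ((ω.2.nth j).faces.1 ∈ D ∧ (ω.2.nth j).faces.2 ∈ D) := by
      rcases hs with rfl | rfl
      · have en : ω.2.nth i = (rootS w).side (ω.2.sIn i) := by rw [YBWalk.nth_eq_side_sIn hi, hfc]
        have hi0 : 0 < i := by rcases hpos with hp | hp; exact hp; exact absurd hp (YBWalk.sIn_ne_sOut hi)
        exact ⟨i, hi0, by omega, en, by rw [en]; rw [← en]; exact ω.2.door_nth hi0 hi⟩
      · have en : ω.2.nth (i + 1) = (rootS w).side (ω.2.sOut i) := by rw [YBWalk.nth_succ_eq_side_sOut hi, hfc]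
        have hi1 : i + 1 < ω.2.arcs.length := by
          by_contra hge
          have heq : i + 1 = ω.2.arcs.length := by omega
          have hlast : ω.2.nth ω.2.arcs.length = (farW w).side ω.1 := ω.2.nth_length
          rw [heq, hlast] at en
          exact farW_side_ne_rootS_side w ω.1 _ en
        exact ⟨i + 1, by omega, by omega, en, by rw [en]; rw [← en]; exact ω.2.door_nth (by omega) hi1⟩
    obtain ⟨j, -, -, en, hd⟩ := hmid
    rw [en] at hd
    cases s with
    | W => exact absurd rfl hsW
    | N => exact hNS
    | E => rw [fE] at hd; exact absurd hd.2 hP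
    | S => rw [fS] at hd; exact absurd hd.1 hSS
  -- which of the two arcs at the door lies in `rootS`?
  have hfaces : ω.2.fc k = rootS w ∨ ω.2.fc (k - 1) = rootS w := by
    have hk0 : 0 < k := by omega
    have e1 : (ω.2.fc k).side (ω.2.sIn k) = (rootS w).side .W := by rw [← YBWalk.nth_eq_side_sIn hkn, e]
    have e2 : (ω.2.fc (k - 1)).side (ω.2.sOut (k - 1)) = (rootS w).side .W := by
      rw [← YBWalk.nth_succ_eq_side_sOut (show k - 1 < ω.2.arcs.length by omega), show k - 1 + 1 = k by omega, e]
    have h1 := (Face.exists_side_eq_iff (ω.2.fc k) ((rootS w).side .W)).1 ⟨_, e1⟩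
    have h2 := (Face.exists_side_eq_iff (ω.2.fc (k - 1)) ((rootS w).side .W)).1 ⟨_, e2⟩
    rw [fW] at h1 h2
    simp only at h1 h2
    have hne := YBWalk.fc_succ_ne (γ := ω.2) (i := k - 1) (by omega)
    rw [show k - 1 + 1 = k by omega] at hne
    rcases h1 with h1 | h1
    · rcases h2 with h2 | h2
      · exact absurd (h2.trans h1.symm) hne
      · exact Or.inr h2
    · exact Or.inl h1
  refine (ω.kindsIn_root_eq_of_cross_root_S hh hr h ?_).2
  rcases hfaces with hfc | hfc
  · -- the walk passes `holeS → rootS`: arc `k` enters `rootS` through `W` and leaves through `N`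
    have hin : ω.2.sIn k = .W := by
      have e1 : (ω.2.fc k).side (ω.2.sIn k) = (rootS w).side .W := by rw [← YBWalk.nth_eq_side_sIn hkn, e]
      rw [hfc] at e1
      exact Face.side_injective _ e1
    have hout : (rootS w).side (ω.2.sOut k) = w.side .S :=
      key hkn hfc (Or.inr rfl) (fun hs => YBWalk.sIn_ne_sOut hkn (hin.trans hs.symm)) (Or.inr rfl)
    refine ⟨k, by omega, hkn, ?_⟩
    rw [YBWalk.nth_succ_eq_side_sOut hkn, hfc, hout]
  · -- the walk passes `rootS → holeS`: arc `k - 1` lies in `rootS`, leaves through `W`, entered through `N`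
    have hk1' : k - 1 < ω.2.arcs.length := by omega
    have hout : ω.2.sOut (k - 1) = .W := by
      have e2 : (ω.2.fc (k - 1)).side (ω.2.sOut (k - 1)) = (rootS w).side .W := by
        rw [← YBWalk.nth_succ_eq_side_sOut hk1', show k - 1 + 1 = k by omega, e]
      rw [hfc] at e2
      exact Face.side_injective _ e2
    have hin : (rootS w).side (ω.2.sIn (k - 1)) = w.side .S :=
      key hk1' hfc (Or.inl rfl) (fun hs => YBWalk.sIn_ne_sOut hk1' (hs.trans hout.symm)) (Or.inl (by omega))
    refine ⟨k - 2, by omega, by omega, ?_⟩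
    rw [show k - 2 + 1 = k - 1 by omega, YBWalk.nth_eq_side_sIn hk1', hfc, hin]


/-- ★★★★ Hence, in that geometry, **no wound walk at the far cell is `w₁`-free off it** — the over route (and the empty
under route) is `w₁`-KILLED by the bottom pocket. [cite: GlazmanManolescu2019, §1, remark after eq. (1) («w₁ = 0 at θ = 2π/3»), Lemma 2.1]
[cite: Glazman2015WeightedSAW, Lemma 3.1 (proof, pp. 6–7)] -/
theorem not_W1FreeOff_of_wound_thinPocketSE (hh : holeFaceW w ∉ D)
    (hcol : ∀ y : ℤ, y ≤ w.2 - 2 → ((w.1 - 1, y) : Face) ∉ D)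
    (hSS : ((w.1, w.2 - 2) : Face) ∉ D) (hP : ((w.1 + 1, w.2 - 1) : Face) ∉ D)
    (ω : ΩG D (w.side .W) (farW w)) (hr : RootedFace D (w.side .W) (farW w)) (h : ω.IsB2a) {θ : ℝ}
    (hW : ω.WE (fun _ => θ) ≠ excursionWinding θ ω.2.firstSideG (ω.z1 hr h) ω.1) : ¬ω.2.W1FreeOff (farW w) := by
  have hk := kindsIn_root_eq_of_wound_thinPocketSE hh hcol hSS hP ω hr h hW
  intro hfree
  have hmem : w ∈ ω.2.facesVisited := by
    by_contra hn
    rw [YBWalk.kindsIn_eq_nil hn] at hk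
    exact List.cons_ne_nil _ _ hk.symm
  exact hfree _ hmem (root_ne_farW w) hk

/-- The over route is `w₁`-killed (the universal kill statement of LAW L, at every angle).
[cite: GlazmanManolescu2019, §1, remark after eq. (1), Lemma 2.1] [cite: Glazman2015WeightedSAW, Lemma 3.1 (proof, pp. 6–7)] -/
theorem over_w1_killed_of_thinPocketSE (hh : holeFaceW w ∉ D)
    (hcol : ∀ y : ℤ, y ≤ w.2 - 2 → ((w.1 - 1, y) : Face) ∉ D)
    (hSS : ((w.1, w.2 - 2) : Face) ∉ D) (hP : ((w.1 + 1, w.2 - 1) : Face) ∉ D)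
    (hr : RootedFace D (w.side .W) (farW w)) (θ : ℝ) :
    ∀ (ω : ΩG D (w.side .W) (farW w)) (h : ω.IsB2a), ω.2.firstSideG = .N →
      ω.WE (fun _ => θ) ≠ excursionWinding θ ω.2.firstSideG (ω.z1 hr h) ω.1 → ¬ω.2.W1FreeOff (farW w) :=
  fun ω h _ hW => not_W1FreeOff_of_wound_thinPocketSE hh hcol hSS hP ω hr h hW

end ΩG

end Literature.Probability.RandomPlanarGeometry.SAW.YangBaxter

namespace Literature.Barriers.CriticalPhenomena.PlaquetteWalk

open Literature.Probability.RandomPlanarGeometry.SAW.YangBaxter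
open Real Complex

/-! ## §1–§2 The new over witnesses of the thin geometry, every position -/

section Witnesses

/-- Thin-box witness block `ON1hr`: the 26 cells of an over w₁-free wound witness (reference root `(4, 2)`, hole
`(3, 2)`, far cell `(2, 2)`) in the rows `≥ 1` (the bottom wall right below the far cell's row) AVOIDING `(3,3)`, `(4,3)`; cells in
`[1,6]×[1,5]` (kit j291350 of the lane). [cite: GlazmanManolescu2019, §2.1 (finite domains of faces)] -/
def thinBlockON1hr42 : List Face := [(1,2),(1,3),(1,4),(1,5),(2,1),(2,2),(2,3),(2,4),(2,5),(3,1),(3,4),(3,5),(4,1),(4,2),(4,4),(4,5),(5,1),(5,2),(5,3),(5,4),(5,5),(6,1),(6,2),(6,3),(6,4),(6,5)]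

/-- Its mid-edges (26 arcs). [cite: GlazmanManolescu2019, §1 (definition of the model), Fig. 1] -/
def thinON1hrMids : List MidEdge :=
  [.vert 4 2, .vert 5 2, .slant 5 3, .slant 5 4, .vert 5 4, .vert 4 4, .vert 3 4, .slant 2 4, .slant 2 3, .vert 2 2, .slant 1 3, .slant 1 4, .slant 1 5, .vert 2 5, .vert 3 5, .vert 4 5, .vert 5 5, .vert 6 5, .slant 6 5, .slant 6 4, .slant 6 3, .slant 6 2, .vert 6 1, .vert 5 1, .vert 4 1, .vert 3 1, .slant 2 2]

/-- The witness as a walk of its block. [cite: GlazmanManolescu2019, §1 (definition of the model), Fig. 1] -/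
def thinON1hrWalk : YBWalk (dom thinBlockON1hr42) (w42.side .W) ((farW w42).side .S) where
  mids := thinON1hrMids
  head_eq := by decide
  getLast_eq := by decide
  nodup := by decide
  arc_mem := arc_mem_of_check (by decide)
  isChain := by decide
  noncross := noncross_of_check (by decide)

/-- The labelled witness. [cite: Glazman2015WeightedSAW, Lemma 3.1 (proof, pp. 6–7)] -/
def ωthinON1hr : ΩG (dom thinBlockON1hr42) (w42.side .W) (farW w42) := ⟨.S, thinON1hrWalk⟩

/-- Certificates: first hit `8`, `26` arcs, no later far-cell arc, first side `N`, w₁-free off the far cell, odd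
eastern-ray count (`1`). [cite: Glazman2015WeightedSAW, Lemma 3.1 (proof, pp. 6–7)] [cite: CourantRobbins1958, Ch. V Appendix §2 (the even–odd rule)] -/
theorem ωthinON1hr_cert : ωthinON1hr.2.firstHitG = 8 ∧ ωthinON1hr.2.arcs.length = 26 ∧
    (∀ j < 26, 8 < j → ωthinON1hr.2.fc j ≠ farW w42) ∧ ωthinON1hr.2.nth 8 = (farW w42).side .N ∧
    ωthinON1hr.2.W1FreeOff (farW w42) ∧
    Odd ((Finset.range 18).filter fun j => eastRayB w42 (ωthinON1hr.2.nth (8 + j + 1)) = true).card := by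
  refine ⟨by decide, by decide, by decide, by decide, by unfold YBWalk.W1FreeOff; decide, by decide⟩

/-- The block at the root plaquette `w`. [cite: GlazmanManolescu2019, §2.1, §4.2 (translation invariance)] -/
def thinBlockON1hr (w : Face) : List Face := thinBlockON1hr42.map (Face.shiftBy (refShift w))

/-- ★★★ The over w₁-free wound witness `ON1hr` at EVERY POSITION. [cite: GlazmanManolescu2019, §4.2 (translation invariance), Lemma 2.1]
[cite: Glazman2015WeightedSAW, Lemma 3.1 (proof, pp. 6–7)] [cite: CourantRobbins1958, Ch. V Appendix §2 (the even–odd rule)] -/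
theorem exists_over_W1FreeOff_of_thinBlockON1hr {Dl : List Face} {w : Face} (hB : ∀ c ∈ thinBlockON1hr w, c ∈ Dl)
    (hr : RootedFace (dom Dl) (w.side .W) (farW w)) (θ : ℝ) :
    ∃ (ω : ΩG (dom Dl) (w.side .W) (farW w)) (h : ω.IsB2a), ω.2.firstSideG = .N ∧
      ω.WE (fun _ => θ) ≠ excursionWinding θ ω.2.firstSideG (ω.z1 hr h) ω.1 ∧ ω.2.W1FreeOff (farW w) := by
  have hB₀ := block42_mem_of_block_mem (B := thinBlockON1hr42) hB
  obtain ⟨hF, hn, hfc, hnth, hfree, hodd⟩ := ωthinON1hr_cert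
  let ω₀ : ΩG (dom (Dl.map (Face.shiftBy (-refShift w)))) (w42.side .W) (farW w42) :=
    ⟨.S, thinON1hrWalk.mapDomain fun c hc => hB₀ c hc⟩
  have hF' : ω₀.2.firstHitG = 8 := hF
  have hn' : ω₀.2.arcs.length = 26 := hn
  have h₀ : ω₀.IsB2a := by
    refine ΩG.isB2a_of_forall_fc_ne (by rw [hF', hn']; omega) fun j hj1 hj2 => ?_
    rw [hF'] at hj1
    rw [hn'] at hj2
    exact hfc j hj2 hj1
  have hM : ω₀.Mv = 18 := by unfold ΩG.Mv; rw [hF', hn']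
  exact exists_wound_witness_shift (shiftBy_refShift_root w) (shiftBy_refShift_farW w) hr
    (fun γ r => γ.W1FreeOff r) (fun hm _ hf => YBWalk.W1FreeOff_of_mids_shift hm hf) ω₀ h₀
    (by rw [hF']; exact hnth) hfree (by rw [hM, hF']; exact hodd) θ

/-- Thin-box witness block `ON2e`: the 19 cells of an over w₂-free wound witness (reference root `(4, 2)`, hole
`(3, 2)`, far cell `(2, 2)`) in the rows `≥ 1` (the bottom wall right below the far cell's row) AVOIDING `(5,2)`, `(5,3)`; cells in
`[1,6]×[1,4]` (kit j291350 of the lane). [cite: GlazmanManolescu2019, §2.1 (finite domains of faces)] -/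
def thinBlockON2e42 : List Face := [(1,2),(1,3),(2,1),(2,2),(2,3),(2,4),(3,1),(3,3),(3,4),(4,1),(4,2),(4,3),(4,4),(5,1),(5,4),(6,1),(6,2),(6,3),(6,4)]

/-- Its mid-edges (20 arcs). [cite: GlazmanManolescu2019, §1 (definition of the model), Fig. 1] -/
def thinON2eMids : List MidEdge :=
  [.vert 4 2, .slant 4 3, .vert 4 3, .vert 3 3, .slant 2 3, .vert 2 2, .slant 1 3, .vert 2 3, .slant 2 4, .vert 3 4, .vert 4 4, .vert 5 4, .vert 6 4, .slant 6 4, .slant 6 3, .slant 6 2, .vert 6 1, .vert 5 1, .vert 4 1, .vert 3 1, .slant 2 2]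

/-- The witness as a walk of its block. [cite: GlazmanManolescu2019, §1 (definition of the model), Fig. 1] -/
def thinON2eWalk : YBWalk (dom thinBlockON2e42) (w42.side .W) ((farW w42).side .S) where
  mids := thinON2eMids
  head_eq := by decide
  getLast_eq := by decide
  nodup := by decide
  arc_mem := arc_mem_of_check (by decide)
  isChain := by decide
  noncross := noncross_of_check (by decide)

/-- The labelled witness. [cite: Glazman2015WeightedSAW, Lemma 3.1 (proof, pp. 6–7)] -/
def ωthinON2e : ΩG (dom thinBlockON2e42) (w42.side .W) (farW w42) := ⟨.S, thinON2eWalk⟩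

/-- Certificates: first hit `4`, `20` arcs, no later far-cell arc, first side `N`, w₂-free off the far cell, odd
eastern-ray count (`1`). [cite: Glazman2015WeightedSAW, Lemma 3.1 (proof, pp. 6–7)] [cite: CourantRobbins1958, Ch. V Appendix §2 (the even–odd rule)] -/
theorem ωthinON2e_cert : ωthinON2e.2.firstHitG = 4 ∧ ωthinON2e.2.arcs.length = 20 ∧
    (∀ j < 20, 4 < j → ωthinON2e.2.fc j ≠ farW w42) ∧ ωthinON2e.2.nth 4 = (farW w42).side .N ∧
    ωthinON2e.2.W2FreeOff (farW w42) ∧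
    Odd ((Finset.range 16).filter fun j => eastRayB w42 (ωthinON2e.2.nth (4 + j + 1)) = true).card := by
  refine ⟨by decide, by decide, by decide, by decide, by unfold YBWalk.W2FreeOff; decide, by decide⟩

/-- The block at the root plaquette `w`. [cite: GlazmanManolescu2019, §2.1, §4.2 (translation invariance)] -/
def thinBlockON2e (w : Face) : List Face := thinBlockON2e42.map (Face.shiftBy (refShift w))

/-- ★★★ The over w₂-free wound witness `ON2e` at EVERY POSITION. [cite: GlazmanManolescu2019, §4.2 (translation invariance), Lemma 2.1]
[cite: Glazman2015WeightedSAW, Lemma 3.1 (proof, pp. 6–7)] [cite: CourantRobbins1958, Ch. V Appendix §2 (the even–odd rule)] -/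
theorem exists_over_W2FreeOff_of_thinBlockON2e {Dl : List Face} {w : Face} (hB : ∀ c ∈ thinBlockON2e w, c ∈ Dl)
    (hr : RootedFace (dom Dl) (w.side .W) (farW w)) (θ : ℝ) :
    ∃ (ω : ΩG (dom Dl) (w.side .W) (farW w)) (h : ω.IsB2a), ω.2.firstSideG = .N ∧
      ω.WE (fun _ => θ) ≠ excursionWinding θ ω.2.firstSideG (ω.z1 hr h) ω.1 ∧ ω.2.W2FreeOff (farW w) := by
  have hB₀ := block42_mem_of_block_mem (B := thinBlockON2e42) hB
  obtain ⟨hF, hn, hfc, hnth, hfree, hodd⟩ := ωthinON2e_cert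
  let ω₀ : ΩG (dom (Dl.map (Face.shiftBy (-refShift w)))) (w42.side .W) (farW w42) :=
    ⟨.S, thinON2eWalk.mapDomain fun c hc => hB₀ c hc⟩
  have hF' : ω₀.2.firstHitG = 4 := hF
  have hn' : ω₀.2.arcs.length = 20 := hn
  have h₀ : ω₀.IsB2a := by
    refine ΩG.isB2a_of_forall_fc_ne (by rw [hF', hn']; omega) fun j hj1 hj2 => ?_
    rw [hF'] at hj1
    rw [hn'] at hj2
    exact hfc j hj2 hj1
  have hM : ω₀.Mv = 16 := by unfold ΩG.Mv; rw [hF', hn']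
  exact exists_wound_witness_shift (shiftBy_refShift_root w) (shiftBy_refShift_farW w) hr
    (fun γ r => γ.W2FreeOff r) (fun hm _ hf => YBWalk.W2FreeOff_of_mids_shift hm hf) ω₀ h₀
    (by rw [hF']; exact hnth) hfree (by rw [hM, hF']; exact hodd) θ

/-- Thin-box witness block `ON1e`: the 20 cells of an over w₁-free wound witness (reference root `(4, 2)`, hole
`(3, 2)`, far cell `(2, 2)`) in the rows `≥ 1` (the bottom wall right below the far cell's row) AVOIDING `(5,2)`, `(5,3)`; cells in
`[1,6]×[1,4]` (kit j291350 of the lane). [cite: GlazmanManolescu2019, §2.1 (finite domains of faces)] -/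
def thinBlockON1e42 : List Face := [(1,2),(1,3),(1,4),(2,1),(2,2),(2,3),(2,4),(3,1),(3,3),(3,4),(4,1),(4,2),(4,3),(4,4),(5,1),(5,4),(6,1),(6,2),(6,3),(6,4)]

/-- Its mid-edges (20 arcs). [cite: GlazmanManolescu2019, §1 (definition of the model), Fig. 1] -/
def thinON1eMids : List MidEdge :=
  [.vert 4 2, .slant 4 3, .vert 4 3, .vert 3 3, .slant 2 3, .vert 2 2, .slant 1 3, .slant 1 4, .vert 2 4, .vert 3 4, .vert 4 4, .vert 5 4, .vert 6 4, .slant 6 4, .slant 6 3, .slant 6 2, .vert 6 1, .vert 5 1, .vert 4 1, .vert 3 1, .slant 2 2]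

/-- The witness as a walk of its block. [cite: GlazmanManolescu2019, §1 (definition of the model), Fig. 1] -/
def thinON1eWalk : YBWalk (dom thinBlockON1e42) (w42.side .W) ((farW w42).side .S) where
  mids := thinON1eMids
  head_eq := by decide
  getLast_eq := by decide
  nodup := by decide
  arc_mem := arc_mem_of_check (by decide)
  isChain := by decide
  noncross := noncross_of_check (by decide)

/-- The labelled witness. [cite: Glazman2015WeightedSAW, Lemma 3.1 (proof, pp. 6–7)] -/
def ωthinON1e : ΩG (dom thinBlockON1e42) (w42.side .W) (farW w42) := ⟨.S, thinON1eWalk⟩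

/-- Certificates: first hit `4`, `20` arcs, no later far-cell arc, first side `N`, w₁-free off the far cell, odd
eastern-ray count (`1`). [cite: Glazman2015WeightedSAW, Lemma 3.1 (proof, pp. 6–7)] [cite: CourantRobbins1958, Ch. V Appendix §2 (the even–odd rule)] -/
theorem ωthinON1e_cert : ωthinON1e.2.firstHitG = 4 ∧ ωthinON1e.2.arcs.length = 20 ∧
    (∀ j < 20, 4 < j → ωthinON1e.2.fc j ≠ farW w42) ∧ ωthinON1e.2.nth 4 = (farW w42).side .N ∧
    ωthinON1e.2.W1FreeOff (farW w42) ∧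
    Odd ((Finset.range 16).filter fun j => eastRayB w42 (ωthinON1e.2.nth (4 + j + 1)) = true).card := by
  refine ⟨by decide, by decide, by decide, by decide, by unfold YBWalk.W1FreeOff; decide, by decide⟩

/-- The block at the root plaquette `w`. [cite: GlazmanManolescu2019, §2.1, §4.2 (translation invariance)] -/
def thinBlockON1e (w : Face) : List Face := thinBlockON1e42.map (Face.shiftBy (refShift w))

/-- ★★★ The over w₁-free wound witness `ON1e` at EVERY POSITION. [cite: GlazmanManolescu2019, §4.2 (translation invariance), Lemma 2.1]
[cite: Glazman2015WeightedSAW, Lemma 3.1 (proof, pp. 6–7)] [cite: CourantRobbins1958, Ch. V Appendix §2 (the even–odd rule)] -/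
theorem exists_over_W1FreeOff_of_thinBlockON1e {Dl : List Face} {w : Face} (hB : ∀ c ∈ thinBlockON1e w, c ∈ Dl)
    (hr : RootedFace (dom Dl) (w.side .W) (farW w)) (θ : ℝ) :
    ∃ (ω : ΩG (dom Dl) (w.side .W) (farW w)) (h : ω.IsB2a), ω.2.firstSideG = .N ∧
      ω.WE (fun _ => θ) ≠ excursionWinding θ ω.2.firstSideG (ω.z1 hr h) ω.1 ∧ ω.2.W1FreeOff (farW w) := by
  have hB₀ := block42_mem_of_block_mem (B := thinBlockON1e42) hB
  obtain ⟨hF, hn, hfc, hnth, hfree, hodd⟩ := ωthinON1e_cert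
  let ω₀ : ΩG (dom (Dl.map (Face.shiftBy (-refShift w)))) (w42.side .W) (farW w42) :=
    ⟨.S, thinON1eWalk.mapDomain fun c hc => hB₀ c hc⟩
  have hF' : ω₀.2.firstHitG = 4 := hF
  have hn' : ω₀.2.arcs.length = 20 := hn
  have h₀ : ω₀.IsB2a := by
    refine ΩG.isB2a_of_forall_fc_ne (by rw [hF', hn']; omega) fun j hj1 hj2 => ?_
    rw [hF'] at hj1
    rw [hn'] at hj2
    exact hfc j hj2 hj1
  have hM : ω₀.Mv = 16 := by unfold ΩG.Mv; rw [hF', hn']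
  exact exists_wound_witness_shift (shiftBy_refShift_root w) (shiftBy_refShift_farW w) hr
    (fun γ r => γ.W1FreeOff r) (fun hm _ hf => YBWalk.W1FreeOff_of_mids_shift hm hf) ω₀ h₀
    (by rw [hF']; exact hnth) hfree (by rw [hM, hF']; exact hodd) θ

/-- Thin-box witness block `ON2hr`: the 24 cells of an over w₂-free wound witness (reference root `(4, 2)`, hole
`(3, 2)`, far cell `(2, 2)`) in the rows `≥ 1` (the bottom wall right below the far cell's row) AVOIDING `(3,3)`, `(4,3)`; cells in
`[1,6]×[1,5]` (kit j291350 of the lane). [cite: GlazmanManolescu2019, §2.1 (finite domains of faces)] -/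
def thinBlockON2hr42 : List Face := [(1,2),(1,3),(1,4),(2,1),(2,2),(2,3),(2,4),(2,5),(3,1),(3,4),(3,5),(4,1),(4,2),(4,4),(4,5),(5,1),(5,2),(5,3),(5,4),(5,5),(6,2),(6,3),(6,4),(6,5)]

/-- Its mid-edges (26 arcs). [cite: GlazmanManolescu2019, §1 (definition of the model), Fig. 1] -/
def thinON2hrMids : List MidEdge :=
  [.vert 4 2, .vert 5 2, .slant 5 3, .slant 5 4, .vert 5 4, .vert 4 4, .vert 3 4, .slant 2 4, .slant 2 3, .vert 2 2, .slant 1 3, .slant 1 4, .vert 2 4, .slant 2 5, .vert 3 5, .vert 4 5, .vert 5 5, .vert 6 5, .slant 6 5, .slant 6 4, .slant 6 3, .vert 6 2, .slant 5 2, .vert 5 1, .vert 4 1, .vert 3 1, .slant 2 2]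

/-- The witness as a walk of its block. [cite: GlazmanManolescu2019, §1 (definition of the model), Fig. 1] -/
def thinON2hrWalk : YBWalk (dom thinBlockON2hr42) (w42.side .W) ((farW w42).side .S) where
  mids := thinON2hrMids
  head_eq := by decide
  getLast_eq := by decide
  nodup := by decide
  arc_mem := arc_mem_of_check (by decide)
  isChain := by decide
  noncross := noncross_of_check (by decide)

/-- The labelled witness. [cite: Glazman2015WeightedSAW, Lemma 3.1 (proof, pp. 6–7)] -/
def ωthinON2hr : ΩG (dom thinBlockON2hr42) (w42.side .W) (farW w42) := ⟨.S, thinON2hrWalk⟩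

/-- Certificates: first hit `8`, `26` arcs, no later far-cell arc, first side `N`, w₂-free off the far cell, odd
eastern-ray count (`1`). [cite: Glazman2015WeightedSAW, Lemma 3.1 (proof, pp. 6–7)] [cite: CourantRobbins1958, Ch. V Appendix §2 (the even–odd rule)] -/
theorem ωthinON2hr_cert : ωthinON2hr.2.firstHitG = 8 ∧ ωthinON2hr.2.arcs.length = 26 ∧
    (∀ j < 26, 8 < j → ωthinON2hr.2.fc j ≠ farW w42) ∧ ωthinON2hr.2.nth 8 = (farW w42).side .N ∧
    ωthinON2hr.2.W2FreeOff (farW w42) ∧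
    Odd ((Finset.range 18).filter fun j => eastRayB w42 (ωthinON2hr.2.nth (8 + j + 1)) = true).card := by
  refine ⟨by decide, by decide, by decide, by decide, by unfold YBWalk.W2FreeOff; decide, by decide⟩

/-- The block at the root plaquette `w`. [cite: GlazmanManolescu2019, §2.1, §4.2 (translation invariance)] -/
def thinBlockON2hr (w : Face) : List Face := thinBlockON2hr42.map (Face.shiftBy (refShift w))

/-- ★★★ The over w₂-free wound witness `ON2hr` at EVERY POSITION. [cite: GlazmanManolescu2019, §4.2 (translation invariance), Lemma 2.1]
[cite: Glazman2015WeightedSAW, Lemma 3.1 (proof, pp. 6–7)] [cite: CourantRobbins1958, Ch. V Appendix §2 (the even–odd rule)] -/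
theorem exists_over_W2FreeOff_of_thinBlockON2hr {Dl : List Face} {w : Face} (hB : ∀ c ∈ thinBlockON2hr w, c ∈ Dl)
    (hr : RootedFace (dom Dl) (w.side .W) (farW w)) (θ : ℝ) :
    ∃ (ω : ΩG (dom Dl) (w.side .W) (farW w)) (h : ω.IsB2a), ω.2.firstSideG = .N ∧
      ω.WE (fun _ => θ) ≠ excursionWinding θ ω.2.firstSideG (ω.z1 hr h) ω.1 ∧ ω.2.W2FreeOff (farW w) := by
  have hB₀ := block42_mem_of_block_mem (B := thinBlockON2hr42) hB
  obtain ⟨hF, hn, hfc, hnth, hfree, hodd⟩ := ωthinON2hr_cert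
  let ω₀ : ΩG (dom (Dl.map (Face.shiftBy (-refShift w)))) (w42.side .W) (farW w42) :=
    ⟨.S, thinON2hrWalk.mapDomain fun c hc => hB₀ c hc⟩
  have hF' : ω₀.2.firstHitG = 8 := hF
  have hn' : ω₀.2.arcs.length = 26 := hn
  have h₀ : ω₀.IsB2a := by
    refine ΩG.isB2a_of_forall_fc_ne (by rw [hF', hn']; omega) fun j hj1 hj2 => ?_
    rw [hF'] at hj1
    rw [hn'] at hj2
    exact hfc j hj2 hj1
  have hM : ω₀.Mv = 18 := by unfold ΩG.Mv; rw [hF', hn']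
  exact exists_wound_witness_shift (shiftBy_refShift_root w) (shiftBy_refShift_farW w) hr
    (fun γ r => γ.W2FreeOff r) (fun hm _ hf => YBWalk.W2FreeOff_of_mids_shift hm hf) ω₀ h₀
    (by rw [hF']; exact hnth) hfree (by rw [hM, hF']; exact hodd) θ

end Witnesses

/-! ## §3 The interior thin box: every near cell but the five door/column cells keeps the defect non-zero -/

section ThinTable

variable {m n : ℕ} {h : Face}

/-- **A reference block with given bounds sits in the box minus a FAR cell**: the removed cell `(cx, cy)` lies outside the
translated bounding box of `B`. [cite: GlazmanManolescu2019, §2.1 (finite domains of faces), §4.2 (translation invariance)] -/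
theorem block_hroot_subset_boxMinus_of_bounds_far (B : List Face) (x0 x1 y0 y1 : ℤ)
    (hB : ∀ a ∈ B, x0 ≤ a.1 ∧ a.1 ≤ x1 ∧ y0 ≤ a.2 ∧ a.2 ≤ y1 ∧ a ≠ (3, 2))
    (hW : 3 ≤ x0 + h.1) (hE : x1 + h.1 ≤ m + 2) (hS : 2 ≤ y0 + h.2) (hN : y1 + h.2 ≤ n + 1) {cx cy : ℤ}
    (hc : cx + 3 < x0 + h.1 ∨ x1 + h.1 < cx + 3 ∨ cy + 2 < y0 + h.2 ∨ y1 + h.2 < cy + 2) :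
    ∀ c ∈ B.map (Face.shiftBy (refShift (h.1 + 1, h.2))), c ∈ boxMinus m n [h, (cx, cy)] := by
  intro c hc'
  rw [List.mem_map] at hc'
  obtain ⟨a, ha, rfl⟩ := hc'
  obtain ⟨b1, b2, b3, b4, b5⟩ := hB a ha
  obtain ⟨x, y⟩ := a
  simp only [ne_eq, Prod.mk.injEq, not_and] at b1 b2 b3 b4 b5
  rw [shiftBy_refShift_mk, mem_boxMinus]
  simp only [List.mem_cons, List.not_mem_nil, or_false, not_or]
  refine ⟨⟨by omega, by omega, by omega, by omega⟩, fun e => ?_, fun e => ?_⟩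
  · have e' := Prod.ext_iff.1 e; simp only at e'; omega
  · have e' := Prod.ext_iff.1 e; simp only at e'; omega

/-- ★★★★★ **THIN-BOX LAW L, THE INTERIOR TABLE: every single removal other than the five door/column cells leaves the
far-cell defect NON-ZERO on the whole hexagonal range.** In the `m × n` box with the hole `h` one row above the bottom wall
(`h.2 = 1`) and at distance `≥ 3` from the west and east walls, `n ≥ 5`, remove the hole and ONE cell `(x, y)` which is none
of: the hole, the far cell `(h.1 − 1, 1)`, the root plaquette `(h.1 + 1, 1)`, the far cell's doors `farSW = (h.1 − 1, 0)`,
`farWW = (h.1 − 2, 1)`, `farNW = (h.1 − 1, 2)`, the cell below the hole `(h.1, 0)`, the cell below the root plaquette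
`(h.1 + 1, 0)`, the bottom cell `pocketSE = (h.1 + 2, 0)` (which `w₁`-kills the over route: `VF(2π/3) = 0`, §4).
Then `VF(θ) ≠ 0` for every `θ ∈ [π/3, 2π/3]` (indeed `Im VF > 0`): the under route is empty and wound
over-walks of both kinds (`w₂`-free, `w₁`-free) survive — far cells by the schema's over blocks, the twelve near cells by the
table (reference coordinates, hole `(3, 2)`; blocks over `w₂`-free · over `w₁`-free): `(1,1)`: OW · OE;
`(5,2)`: ON2e · ON1e; `(1,3)`: ON2c · INW; `(3,3)`, `(4,3)`: ON2hr · ON1hr; `(5,3)`: ON2e · ON1e; `(1,4)`: OW · INW; `(2,4)`, `(3,4)`, `(4,4)`: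
ON2a · INW; `(5,4)`: INE · OE. The excluded cells give `VF ≡ 0` (`lawL_box_farSW_eq_zero`, `lawL_box_farWW_eq_zero`,
`lawL_box_farNW_eq_zero`, `thinBox_holeS_…`, `thinBox_rootS_…`). [cite: GlazmanManolescu2019, Lemma 2.1 (statement, "in the form given in [Gl]"), §2.1, §4.2]
[cite: Glazman2015WeightedSAW, Lemma 3.1 (proof, pp. 6–7)] [cite: CourantRobbins1958, Ch. V Appendix §2 (the even–odd rule)] -/
theorem thinBox_cell_vertexFunctional_ne_zero (hW : 3 ≤ h.1) (hE : h.1 + 4 ≤ m) (hS : h.2 = 1) (hN : 5 ≤ n) {x y : ℤ}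
    (hc : ¬((x = h.1 ∧ y = 1) ∨ (x = h.1 - 1 ∧ y = 1) ∨ (x = h.1 + 1 ∧ y = 1) ∨ (x = h.1 - 1 ∧ y = 0) ∨
      (x = h.1 - 2 ∧ y = 1) ∨ (x = h.1 - 1 ∧ y = 2) ∨ (x = h.1 ∧ y = 0) ∨ (x = h.1 + 1 ∧ y = 0) ∨ (x = h.1 + 2 ∧ y = 0)))
    {θ : ℝ} (hθ : θ ∈ Set.Icc (π / 3) (2 * π / 3)) :
    vertexFunctional (printedWeights θ) tFiveEighths (ybCoeff θ) (boxMinus m n [h, (x, y)]) (Face.side (h.1 + 1, h.2) .W)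
      (farW (h.1 + 1, h.2)) ≠ 0 := by
  obtain ⟨hf, hh, hKS, hT, hcolS⟩ := thinBox_hyps (m := m) (n := n) (S := [h, (x, y)]) (by omega) (by omega) hS
    (by omega) (by simp) (by
      rw [List.mem_cons, List.mem_singleton, not_or]
      exact ⟨fun e => by have := (Prod.ext_iff.1 e).1; simp only at this; omega,
        fun e => by have e1 := (Prod.ext_iff.1 e).1; have e2 := (Prod.ext_iff.1 e).2; simp only at e1 e2; omega⟩)
  have hr := rootedFace_hroot_boxMinus_of_mem hf (List.mem_cons_self ..)
  have sub := block_hroot_subset_boxMinus_of_bounds (m := m) (n := n) (h := h)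
  by_cases hnear : h.1 - 2 ≤ x ∧ x ≤ h.1 + 2 ∧ 0 ≤ y ∧ y ≤ 3
  · obtain ⟨hx1, hx2, hy1, hy2⟩ := hnear
    have hy : y = 0 ∨ y = 1 ∨ y = 2 ∨ y = 3 := by omega
    have hx : x = h.1 - 2 ∨ x = h.1 - 1 ∨ x = h.1 ∨ x = h.1 + 1 ∨ x = h.1 + 2 := by omega
    rcases hy with rfl | rfl | rfl | rfl <;> rcases hx with rfl | rfl | rfl | rfl | rfl
    -- row 0: (1,1) pocketSW · farSW ✗ · holeS ✗ · rootS ✗ · (5,1) pocketSE ✗ (w₁-kill)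
    · exact vertexFunctional_printed_ne_zero_of_thinS_of_witnesses hθ hf hh hKS hT hcolS hr
        (fun θ' => exists_over_w2free_of_overBlockW (sub overBlockW42 1 5 1 4 1 1 (by decide) (by omega) (by omega)
          (by omega) (by omega) ⟨by omega, by omega⟩) hr θ')
        (fun θ' => exists_over_w1free_of_overBlockE (sub overBlockE42 1 5 1 4 1 1 (by decide) (by omega) (by omega)
          (by omega) (by omega) ⟨by omega, by omega⟩) hr θ')
    · exact absurd (Or.inr (Or.inr (Or.inr (Or.inl ⟨rfl, rfl⟩)))) hc
    · exact absurd (Or.inr (Or.inr (Or.inr (Or.inr (Or.inr (Or.inr (Or.inl ⟨rfl, rfl⟩))))))) hc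
    · exact absurd (Or.inr (Or.inr (Or.inr (Or.inr (Or.inr (Or.inr (Or.inr (Or.inl ⟨rfl, rfl⟩)))))))) hc
    · exact absurd (Or.inr (Or.inr (Or.inr (Or.inr (Or.inr (Or.inr (Or.inr (Or.inr ⟨rfl, rfl⟩)))))))) hc
    -- row 1: farWW ✗ · farW ✗ · hole ✗ · w ✗ · (5,2) rootE
    · exact absurd (Or.inr (Or.inr (Or.inr (Or.inr (Or.inl ⟨rfl, rfl⟩))))) hc
    · exact absurd (Or.inr (Or.inl ⟨rfl, rfl⟩)) hc
    · exact absurd (Or.inl ⟨rfl, rfl⟩) hc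
    · exact absurd (Or.inr (Or.inr (Or.inl ⟨rfl, rfl⟩))) hc
    · exact vertexFunctional_printed_ne_zero_of_thinS_of_witnesses hθ hf hh hKS hT hcolS hr
        (fun θ' => exists_over_W2FreeOff_of_thinBlockON2e (sub thinBlockON2e42 1 6 1 4 5 2 (by decide) (by omega) (by omega)
          (by omega) (by omega) ⟨by omega, by omega⟩) hr θ')
        (fun θ' => exists_over_W1FreeOff_of_thinBlockON1e (sub thinBlockON1e42 1 6 1 4 5 2 (by decide) (by omega) (by omega)
          (by omega) (by omega) ⟨by omega, by omega⟩) hr θ')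
    -- row 2: (1,3) pocketNW · farNW ✗ · (3,3) holeN · (4,3) rootN · (5,3) pocketNE
    · exact vertexFunctional_printed_ne_zero_of_thinS_of_witnesses hθ hf hh hKS hT hcolS hr
        (fun θ' => exists_over_W2FreeOff_of_ringBlockON2c (sub ringBlockON2c42 0 5 1 4 1 3 (by decide) (by omega) (by omega)
          (by omega) (by omega) ⟨by omega, by omega⟩) hr θ')
        (fun θ' => exists_over_w1free_of_interiorBlockNW (sub interiorBlockNW42 0 5 1 5 1 3 (by decide) (by omega) (by omega)
          (by omega) (by omega) ⟨by omega, by omega⟩) hr θ')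
    · exact absurd (Or.inr (Or.inr (Or.inr (Or.inr (Or.inr (Or.inl ⟨rfl, rfl⟩)))))) hc
    · exact vertexFunctional_printed_ne_zero_of_thinS_of_witnesses hθ hf hh hKS hT hcolS hr
        (fun θ' => exists_over_W2FreeOff_of_thinBlockON2hr (sub thinBlockON2hr42 1 6 1 5 3 3 (by decide) (by omega) (by omega)
          (by omega) (by omega) ⟨by omega, by omega⟩) hr θ')
        (fun θ' => exists_over_W1FreeOff_of_thinBlockON1hr (sub thinBlockON1hr42 1 6 1 5 3 3 (by decide) (by omega) (by omega)
          (by omega) (by omega) ⟨by omega, by omega⟩) hr θ')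
    · exact vertexFunctional_printed_ne_zero_of_thinS_of_witnesses hθ hf hh hKS hT hcolS hr
        (fun θ' => exists_over_W2FreeOff_of_thinBlockON2hr (sub thinBlockON2hr42 1 6 1 5 4 3 (by decide) (by omega) (by omega)
          (by omega) (by omega) ⟨by omega, by omega⟩) hr θ')
        (fun θ' => exists_over_W1FreeOff_of_thinBlockON1hr (sub thinBlockON1hr42 1 6 1 5 4 3 (by decide) (by omega) (by omega)
          (by omega) (by omega) ⟨by omega, by omega⟩) hr θ')
    · exact vertexFunctional_printed_ne_zero_of_thinS_of_witnesses hθ hf hh hKS hT hcolS hr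
        (fun θ' => exists_over_W2FreeOff_of_thinBlockON2e (sub thinBlockON2e42 1 6 1 4 5 3 (by decide) (by omega) (by omega)
          (by omega) (by omega) ⟨by omega, by omega⟩) hr θ')
        (fun θ' => exists_over_W1FreeOff_of_thinBlockON1e (sub thinBlockON1e42 1 6 1 4 5 3 (by decide) (by omega) (by omega)
          (by omega) (by omega) ⟨by omega, by omega⟩) hr θ')
    -- row 3: (1,4) K_N1 · (2,4) · (3,4) · (4,4) · (5,4) K_N2
    · exact vertexFunctional_printed_ne_zero_of_thinS_of_witnesses hθ hf hh hKS hT hcolS hr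
        (fun θ' => exists_over_w2free_of_overBlockW (sub overBlockW42 1 5 1 4 1 4 (by decide) (by omega) (by omega)
          (by omega) (by omega) ⟨by omega, by omega⟩) hr θ')
        (fun θ' => exists_over_w1free_of_interiorBlockNW (sub interiorBlockNW42 0 5 1 5 1 4 (by decide) (by omega) (by omega)
          (by omega) (by omega) ⟨by omega, by omega⟩) hr θ')
    · exact vertexFunctional_printed_ne_zero_of_thinS_of_witnesses hθ hf hh hKS hT hcolS hr
        (fun θ' => exists_over_W2FreeOff_of_ringBlockON2a (sub ringBlockON2a42 1 5 1 5 2 4 (by decide) (by omega) (by omega)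
          (by omega) (by omega) ⟨by omega, by omega⟩) hr θ')
        (fun θ' => exists_over_w1free_of_interiorBlockNW (sub interiorBlockNW42 0 5 1 5 2 4 (by decide) (by omega) (by omega)
          (by omega) (by omega) ⟨by omega, by omega⟩) hr θ')
    · exact vertexFunctional_printed_ne_zero_of_thinS_of_witnesses hθ hf hh hKS hT hcolS hr
        (fun θ' => exists_over_W2FreeOff_of_ringBlockON2a (sub ringBlockON2a42 1 5 1 5 3 4 (by decide) (by omega) (by omega)
          (by omega) (by omega) ⟨by omega, by omega⟩) hr θ')
        (fun θ' => exists_over_w1free_of_interiorBlockNW (sub interiorBlockNW42 0 5 1 5 3 4 (by decide) (by omega) (by omega)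
          (by omega) (by omega) ⟨by omega, by omega⟩) hr θ')
    · exact vertexFunctional_printed_ne_zero_of_thinS_of_witnesses hθ hf hh hKS hT hcolS hr
        (fun θ' => exists_over_W2FreeOff_of_ringBlockON2a (sub ringBlockON2a42 1 5 1 5 4 4 (by decide) (by omega) (by omega)
          (by omega) (by omega) ⟨by omega, by omega⟩) hr θ')
        (fun θ' => exists_over_w1free_of_interiorBlockNW (sub interiorBlockNW42 0 5 1 5 4 4 (by decide) (by omega) (by omega)
          (by omega) (by omega) ⟨by omega, by omega⟩) hr θ')
    · exact vertexFunctional_printed_ne_zero_of_thinS_of_witnesses hθ hf hh hKS hT hcolS hr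
        (fun θ' => exists_over_w2free_of_interiorBlockNE (sub interiorBlockNE42 1 6 1 5 5 4 (by decide) (by omega) (by omega)
          (by omega) (by omega) ⟨by omega, by omega⟩) hr θ')
        (fun θ' => exists_over_w1free_of_overBlockE (sub overBlockE42 1 5 1 4 5 4 (by decide) (by omega) (by omega)
          (by omega) (by omega) ⟨by omega, by omega⟩) hr θ')
  · -- far cell: both over blocks of the schema avoid it
    have subF := block_hroot_subset_boxMinus_of_bounds_far (m := m) (n := n) (h := h)
    exact vertexFunctional_printed_ne_zero_of_thinS_of_witnesses hθ hf hh hKS hT hcolS hr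
      (fun θ' => exists_over_w2free_of_overBlockW (subF overBlockW42 1 5 1 4 (by decide) (by omega) (by omega)
        (by omega) (by omega) (by omega)) hr θ')
      (fun θ' => exists_over_w1free_of_overBlockE (subF overBlockE42 1 5 1 4 (by decide) (by omega) (by omega)
        (by omega) (by omega) (by omega)) hr θ')

end ThinTable

/-! ## §4 The bottom pocket `pocketSE = (h.1 + 2, 0)` of a thin box: an isolated zero at the dual angle -/

section PocketSE

variable {m n : ℕ} {h : Face}

/-- ★★★★★ **THIN BOX, THE BOTTOM CELL BELOW `rootE` REMOVED ⇒ `VF(2π/3) = 0` EXACTLY.** In the `m × n` box with the hole `h`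
one row above the bottom wall (`h.2 = 1`, `2 ≤ h.1 ≤ m − 3`, `n ≥ 2`), removing the bottom cell `(h.1 + 2, 0)` (south-east of
the root plaquette) makes every wound walk carry two `θ`-corner arcs in the root plaquette (`ΩG.kindsIn_root_eq_of_wound_thinPocketSE`:
the winding excursion must take the door `holeS | rootS` and can leave `rootS` only northwards) — the over route is `w₁`-KILLED,
the under route empty: both route masses vanish at the dual angle. [cite: GlazmanManolescu2019, §1 (remark after eq. (1)), §2.1, Lemma 2.1]
[cite: Glazman2015WeightedSAW, Lemma 3.1 (proof, pp. 6–7)] [cite: CourantRobbins1958, Ch. V Appendix §2 (the even–odd rule)] -/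
theorem thinBox_pocketSE_vertexFunctional_two_pi_div_three_eq_zero (hW : 2 ≤ h.1) (hE : h.1 + 3 ≤ m) (hS : h.2 = 1)
    (hN : 2 ≤ n) :
    vertexFunctional (printedWeights (2 * π / 3)) tFiveEighths (ybCoeff (2 * π / 3))
      (boxMinus m n [h, (h.1 + 2, 0)]) (Face.side (h.1 + 1, h.2) .W) (farW (h.1 + 1, h.2)) = 0 := by
  obtain ⟨hf, hh, hKS, hT, hcolS⟩ := thinBox_hyps (m := m) (n := n) (S := [h, (h.1 + 2, 0)]) hW (by omega) hS hN
    (by simp) (by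
      rw [List.mem_cons, List.mem_singleton, not_or]
      exact ⟨fun e => by have := (Prod.ext_iff.1 e).1; simp only at this; omega,
        fun e => by have := (Prod.ext_iff.1 e).1; simp only at this; omega⟩)
  have hr := rootedFace_hroot_boxMinus_of_mem hf (by simp)
  refine vertexFunctional_printed_two_pi_div_three_eq_zero_of_thinS_of_over_w1_killed hf hh hKS hT hcolS hr ?_
  refine ΩG.over_w1_killed_of_thinPocketSE hh (fun y hy hm => ?_) (fun hm => ?_) ?_ hr _
  · have hb := (mem_dom_boxMinus.1 hm).1; simp only at hb hy; omega
  · have hb := (mem_dom_boxMinus.1 hm).1; simp only at hb; omega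
  · have e : ((((h.1 + 1, h.2) : Face).1 + 1, ((h.1 + 1, h.2) : Face).2 - 1) : Face) = (h.1 + 2, 0) :=
      Prod.ext (by simp only; omega) (by simp only; omega)
    rw [e]; exact not_mem_dom_boxMinus_of_mem (by simp)

/-- … while `Im VF(θ) > 0` — so `VF(θ) ≠ 0` — for every `θ ∈ [π/3, 2π/3)` (`n ≥ 4`: the `w₂`-free over block survives):
an ISOLATED ENDPOINT ZERO from a BOTTOM-row cell, companion of the top-row ones of `PlaquetteWalkHoleRootThinBoxCells` §5.
[cite: GlazmanManolescu2019, §1 (Fig. 2), §2.1, Lemma 2.1] [cite: Glazman2015WeightedSAW, Lemma 3.1 (proof, pp. 6–7)] -/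
theorem thinBox_pocketSE_im_pos_of_lt (hW : 2 ≤ h.1) (hE : h.1 + 3 ≤ m) (hS : h.2 = 1) (hN : 4 ≤ n) {θ : ℝ}
    (hθ : θ ∈ Set.Ico (π / 3) (2 * π / 3)) :
    0 < (vertexFunctional (printedWeights θ) tFiveEighths (ybCoeff θ) (boxMinus m n [h, (h.1 + 2, 0)])
      (Face.side (h.1 + 1, h.2) .W) (farW (h.1 + 1, h.2))).im := by
  obtain ⟨hf, hh, hKS, hT, hcolS⟩ := thinBox_hyps (m := m) (n := n) (S := [h, (h.1 + 2, 0)]) hW (by omega) hS (by omega)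
    (by simp) (by
      rw [List.mem_cons, List.mem_singleton, not_or]
      exact ⟨fun e => by have := (Prod.ext_iff.1 e).1; simp only at this; omega,
        fun e => by have := (Prod.ext_iff.1 e).1; simp only at this; omega⟩)
  have hr := rootedFace_hroot_boxMinus_of_mem hf (by simp)
  have hB : ∀ c ∈ overBlockW (h.1 + 1, h.2), c ∈ boxMinus m n [h, (h.1 + 2, 0)] :=
    block_hroot_subset_boxMinus_of_bounds (m := m) (n := n) (h := h) overBlockW42 1 5 1 4 5 1 (by decide)
      (by omega) (by omega) (by omega) (by omega) ⟨by omega, by omega⟩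
  exact im_vertexFunctional_printed_pos_of_thinS_of_w2free hθ hf hh hKS hT hcolS hr
    fun θ' => exists_over_w2free_of_overBlockW hB hr θ'

end PocketSE

end Literature.Barriers.CriticalPhenomena.PlaquetteWalk
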